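import Literature.MathematicalPhysics.QuantumFieldTheory.Balaban1983to89.B8Thm32GBoundCubeMember
import Literature.MathematicalPhysics.QuantumFieldTheory.Balaban1983to89.Node00.CarriersB8CubeDented

/-!
# `Balaban1983to89.B8Thm32GBoundDentedCubeMember` — [Balaban1985BackgroundPropagators] THEOREM 3.2 (3.48) at `U = 1` ON THE DENTED CUBE MEMBER OF [Balaban1985Variational]
# (148)–(150), NAMED: the 𝒢-bound `GBoundDentedCubeMemberPrinted d ℓ : Prop` — the SECOND named analytic input of the (β) road (twin of dag-n05-c's
# `B8Thm32GBoundCubeMember.GBoundCubeMemberPrinted` for NODE 00's dented datum `CubeB8D`)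

statement-level skeleton of published theorems with citation tags; proofs where landed; nothing here is a claim about the
Yang–Mills mass gap

`[Balaban1985BackgroundPropagators]` ("[4]", CMP **99** (1985) 389–434) Theorem 3.2 (3.48) p. 398 («Under the assumptions of Theorem 3.1, and with the same constants,
|(Q′(U)G′²(U)Q′*(U))⁻¹(y,y′)| ≦ B₀ … e^{−δd(y,y′)}»), Theorem 3.1 (3.47) p. 398; `[Balaban1985RegularSpaces]` ("B8" = [6]) (1.91)–(1.92) p. 91, p. 92 («from Theorems 3.1, 3.2 of
[4] it follows …»), p. 98, (1.3)–(1.4) p. 77; `[Balaban1985Variational]` ("[15]", CMP **102** (1985) 277–309) p. 300 («a cube □ intersecting Ω_j but not Ω_{j+1}»), (148)–(150)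
p. 301 («Ω′_j = □_j, j = 0, 1, …, k − 1»; «H′_k … defined by (46) … for the sequence {Ω′_j} instead of {Ω_j}»), (151) p. 301; `[Balaban1984PropagatorsII]` ("B6") Prop. 2.3
(2.87) p. 238, Lemma 2.1 (2.61) p. 234.  PDF held: `paper:balaban1985-cmp99-regular-spaces-gauge-fixing`, `paper:balaban1985-cmp102-variational-background` (pp. 24–25).

CITATION HEADER (lean-in-tree rule).  Cell `pub-ymgap` (YM Track A, HUMAN RULING D-0062), DAG node N05 = [B8], seat `pub-ymgap-dag-n05-e` (g31; FAN-OUT §N05 row s3b,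
Proposition-6 lane; the (β) road — this seat WORD I.41343, dag-n05-c PRICE I.41357, NODE 00 datum (d1) p655171, (d2-a) p659647 ∕ p659892, sizing note I.42350).  WHY THIS
FILE.  The UNCONDITIONAL pure crown `B8Prop6CubeMemberScalarGammaHolds.gaugedBoundB8_cubeMember_scalar_γ_holds` ([6] Proposition 6 as `Node00.GaugedBoundB8` at every
pure cube) plugs TWO analytic named facts, both proved in the tree for the PURE member: (1.59)♭ `B8Ineq159FlatCubeMemberPrinted.Ineq159FlatCubeMemberPrinted` ([4] Thm 3.3;
dag-n05-c's torus transplant) and the 𝒢-bound `B8Thm32GBoundCubeMember.GBoundCubeMemberPrinted` ([4] Thm 3.2; dag-n05-c's `B8Thm32GBoundCubeMemberHolds`, transfer to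
lit-balaban's [B6] level-0 box estimates through the box member `B8CubeMemberBoxDomainsL0.cubeDomainsL0`).  The dented road ((β): `Node00.GaugedBoundB8D` at a dented
member, [15] p. 300–301) needs the dented twins of BOTH; the (1.59)♭ twin is `B8Ineq159FlatDentedCubeMemberPrinted` (p659892).  THIS FILE names the second:
`GBoundDentedCubeMemberPrinted d ℓ` = the matrix of `GBoundCubeMemberPrinted` VERBATIM at the top truncation `n = k`, with the truncated cells `cubeLamS … n` REPLACED by
the dented cells `c.lamS` of p655171 (the averaging operator `Q` and the weighted site operator `K` live on the cells; the site set `S = □₀ = c.sq 0` is unchanged),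
quantified over the dented data `c : CubeB8D (d+1) (ℓ+1) K Ω`, the sub-lattice side conditions on `c.M, c.ρ` verbatim (`M_h ≥ 3` free, as in the pure def), PLUS the one
premise the dent costs — «`Ω_k` is a union of cubes of side `M_hL^{k+1}` (= `B6MultiLevelBoxOperator.bigSide ℓ M_h k`) of the grid anchored at `□_k`'s fine lower corner
`Lᵏ(c.a − c.ρ)`» ([6] (1.4)₂ on the grid carrying `□_k`), so that the dented box ∕ torus member (`B8CubeMemberTorusDomainsDented.cubeTDomainsDented`, its `toDomains`) is
available to a dented transfer exactly as `cubeDomainsL0` is to the pure one.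

WHAT THIS FILE DECLARES.  `GBoundDentedCubeMemberPrinted (d ℓ : ℕ) : Prop` — a `def`, NOT an axiom, NOT proved here (OPEN in the tree: its proof is the dented twin of
`B8Thm32GBoundCubeMemberHolds`, dag-n05-c's lineage ∕ a clone — the box rows `B8CubeMemberBoxRowsL0` re-read on the dented `Domains`); nothing consumes it silently.
HONEST SCOPE ∕ NOT CLAIMED.  A named published estimate on the dented member; nothing of [4]∕[6]∕[15] asserted as a theorem; count-neutral; N05 ∕ N07 NOT discharged; one
finite `T⁴` programme at fixed `ε`, Bałaban as printed; nothing continuum ∕ ℝ⁴ ∕ OS ∕ mass-gap ∕ Clay.  No `sorry`, no `instance`, no `notation`; one `def` (a `Prop`).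
Unit `pub-ymgap-dag-n05-e` (g31), 2026-08-28.

RELATED IN THE TREE, NOT DUPLICATED (`rg` 2026-08-28T19:50Z: `ls Balaban1983to89 | grep -ci 'GBoundDented'` = 0): `B8Thm32GBoundCubeMember.GBoundCubeMemberPrinted` (dag-n05-c;
the PURE fact — the model), `B8Thm32GBoundCubeMemberHolds.gBoundCubeMemberPrinted_of_one_le` (its proof, pure member), `Node00.CubeB8D ∕ .sq ∕ .lamS` (p655171; USED),
`B8Ineq159FlatDentedCubeMemberPrinted` (p659892; the sibling (1.59)♭ fact), `B8CubeMemberTorusDomainsDented.hΩ_of_anchored ∕ anchored_of_bigCubes14` (p659647; the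
premise's readings).
-/
noncomputable section

namespace Literature.MathematicalPhysics.QuantumFieldTheory.Balaban1983to89.B8Thm32GBoundDentedCubeMember

open scoped Matrix
open B7Prop1Explicit (e)
open B8LambdaSpaceKLevel (wt)
open B8Eq1101CubeMemberWeights (wPrinted)
open Node00 (CubeB8D)
open Literature.MathematicalPhysics.QuantumLattice (blockMap)

open Classical in
/-- **[Balaban1985BackgroundPropagators] THEOREM 3.2 (3.48) AT `U = 1` ON THE DENTED CUBE MEMBER `{Ω′_j}` OF [Balaban1985Variational] (148)–(150), TOP TRUNCATION,
ROW-SUMMED, IN THE p6 CONSUMER'S NORMALISATION — THE DENTED 𝒢-BOUND** («|(Q′(U)G′²(U)Q′*(U))⁻¹(y,y′)| ≦ B₀(Lʲη)^{…}(L^{j′}η)^{…}e^{−δd(y,y′)}, y ∈ Λ_j, y′ ∈ Λ_{j′}»,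
summed over `y′` with [B6] Lemma 2.1, for the operators «defined … for the sequence {Ω′_j} instead of {Ω_j}» ([15] p. 301)).  For the explicit matrices of the p6 flat
consumer at the printed weights `wPrinted` (`L = ℓ + 1`, dimension `d + 1`) built on the DENTED cells: there are `C_𝒢 ≥ 0`, thresholds `ρ₀, M₀` and `N₀` such that for
every `η > 0`, `M_h ≥ 3` with `M₀ ≤ L·M_h`, every dented cube datum `c : CubeB8D (d+1) (ℓ+1) K Ω` on print's big-block sub-lattice (`M_hL ∣ c.ρ`, `M_hL ∣ c.M`,
`R·M_hL ≤ c.ρ`, `2L ≤ R`, `N₀ + 1 ≤ R·L·M_h`, `ρ₀ ≤ c.ρ`) whose ambient top member `Ω_k` is a union of cubes of side `M_hL^{k+1}` of the grid anchored at `□_k`'s fine lower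
corner `Lᵏ(c.a − c.ρ)` ((1.4)₂), with `S = Ω′₀ = □₀`, `B = {(j, y) : j ≤ k, y ∈ Λ′_j}` the dented cells (`c.lamS`), `K` the flat site operator weighted on the dented cells,
`T, Q` as displayed: the operator `𝒢 = (QT⁻¹T⁻¹Qᵀ)⁻¹` satisfies `wt(j_p)⁴·L^{−(d+1)j_p}·|(𝒢X)_p| ≤ C_𝒢·sup|X|` for every `X` on the dented towers.  The matrix of dag-n05-c's
`GBoundCubeMemberPrinted` at `n = k` with `cubeLamS … k ↦ c.lamS` (and `cubeFam false … 0 = c.sq 0 = □₀`), plus the anchored dent premise.  OPEN in the tree; print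
proves it by the random-walk expansion of [B6] Prop. 2.3, insensitive to the shape of the top member beyond (1.4).
[cite: Balaban1985BackgroundPropagators, Theorem 3.2 (3.48) p.398, Theorem 3.1 (3.47) p.398; Balaban1985Variational, (148)–(151) p.301, p.300; Balaban1985RegularSpaces, (1.91)–(1.92) p.91, p.98, (1.4) p.77; Balaban1984PropagatorsII, Prop. 2.3 (2.87) p.238, Lemma 2.1 (2.61) p.234] -/
def GBoundDentedCubeMemberPrinted (d ℓ : ℕ) : Prop :=
  ∃ CG ρ₀ M₀ : ℝ, ∃ N₀ : ℕ, 0 ≤ CG ∧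
    ∀ (η : ℝ), 0 < η → ∀ (Mh : ℕ), 3 ≤ Mh → M₀ ≤ ((ℓ : ℝ) + 1) * Mh →
    ∀ (K' : ℕ) (Ω : ℕ → Set (Fin (d + 1) → ℤ)) (c : CubeB8D (d + 1) (ℓ + 1) K' Ω) (R : ℕ),
      Mh * (ℓ + 1) ∣ c.ρ → Mh * (ℓ + 1) ∣ c.M → R * (Mh * (ℓ + 1)) ≤ c.ρ → 2 * (ℓ + 1) ≤ R → N₀ + 1 ≤ R * ((ℓ + 1) * Mh) → ρ₀ ≤ (c.ρ : ℝ) →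
      (∀ x y : Fin (d + 1) → ℤ,
          blockMap (Mh * (ℓ + 1) ^ (c.k + 1)) (x - fun i => (((ℓ + 1 : ℕ) : ℤ)) ^ c.k * (c.a i - c.ρ)) =
            blockMap (Mh * (ℓ + 1) ^ (c.k + 1)) (y - fun i => (((ℓ + 1 : ℕ) : ℤ)) ^ c.k * (c.a i - c.ρ)) → x ∈ Ω c.k → y ∈ Ω c.k) →
    ∀ (S : Finset (Fin (d + 1) → ℤ)), (∀ z, z ∈ S ↔ z ∈ c.sq 0) →
    ∀ (B : Finset (ℕ × (Fin (d + 1) → ℤ))), (∀ p, p ∈ B ↔ p.1 ≤ c.k ∧ p.2 ∈ c.lamS p.1) →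
    ∀ (K : (Fin (d + 1) → ℤ) → (Fin (d + 1) → ℤ) → ℝ), (∀ x z, K x z =
        ((η ^ 2)⁻¹ * ∑ μ : Fin (d + 1), ((2 : ℝ) * (if z = x then (1 : ℝ) else 0) - (if z = x + e μ then (1 : ℝ) else 0)
          - (if z = x - e μ then (1 : ℝ) else 0))) +
        (∑ j ∈ Finset.range (c.k + 1), (if blockMap ((ℓ + 1) ^ j) x ∈ c.lamS j ∧
            blockMap ((ℓ + 1) ^ j) z = blockMap ((ℓ + 1) ^ j) x then
          wPrinted d ℓ η j * (((((ℓ + 1 : ℕ) : ℝ) ^ (d + 1))⁻¹) ^ j) ^ 2 else 0))) →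
    ∀ (T : Matrix ↥S ↥S ℝ), T = Matrix.of (fun x z : ↥S => K x.1 z.1) →
    ∀ (Q : Matrix ↥B ↥S ℝ), Q = Matrix.of (fun (p : ↥B) (z : ↥S) =>
        if blockMap ((ℓ + 1) ^ p.1.1) z.1 = p.1.2 then (((((ℓ + 1 : ℕ) : ℝ)) ^ (d + 1))⁻¹) ^ p.1.1 else 0) →
    ∀ (X : ↥B → ℝ) (s : ℝ), 0 ≤ s → (∀ p', |X p'| ≤ s) → ∀ p : ↥B,
      wt (ℓ + 1) η p.1.1 ^ 4 * (((((ℓ + 1 : ℕ) : ℝ)) ^ (d + 1)) ^ p.1.1)⁻¹ * |∑ p' : ↥B, (Q * T⁻¹ * T⁻¹ * Qᵀ)⁻¹ p p' * X p'| ≤ CG * s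

end Literature.MathematicalPhysics.QuantumFieldTheory.Balaban1983to89.B8Thm32GBoundDentedCubeMember

end
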